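import Mathlib
import HarnessLib
import Summits.NavierStokesRegularity.NavierStokesRegularity.Theorems.WakeRatchetMinimalViscousBlowupRetreatDepth
import Summits.NavierStokesRegularity.NavierStokesRegularity.Theorems.WakeRatchetMinimalViscousBlowupLitMeasure
import Summits.NavierStokesRegularity.NavierStokesRegularity.Theorems.WakeRatchetMinimalViscousBlowupFrontClockResidue

/-!
# Route `WakeRatchet`, crux `MinimalViscousBlowup` (stmt-NavierStokesRegularity-22743) — LINE g12-2 (ns-idea-1 g12):
# THE CLOCK RESIDUE, EXACTLY — (FC′) ⟺ (H1″) ∧ (H2″)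

`firedFrontClock_iff_litMeasure_retreatDepth`: along an enveloped blow-up of the NS-scaled `ν`-viscous cascade lattice with the cascade datum
(S5's binders in LINE g11-1 v3.9), the FIRED FRONT CLOCK «`T − t ≤ Kλ^{−2m}` once shell `m` fired by `t`» (the conclusion of S5b♭
`stub_firedFrontClockAtThreshold`) is EQUIVALENT to (H1″) «lit measure `≤ Aλ^{−2k}` at the darkness level `ν²/(32768λ¹⁹)`» ∧ (H2″) «bounded
retreat depth».  Assembled from `litMeasure_of_frontClock₂` (LitMeasure), `retreatDepth_of_frontClock` (RetreatDepth) and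
`frontClock_of_litMeasure_retreatDepth₂` (FrontClockResidue); and `frontClock_of_typeOne`: the pointwise Type-I clock `Λⁿ(T−t)‖X_n(t)‖ ≤ C'` (first half
of S5♭'s conclusion) already implies (FC′) — the S5♭ = S5a ∧ S5b♭ cut has no slack.  MODEL lattice only; nothing about Navier–Stokes; no route item is claimed.
ns-idea-1 g12's kernel-checked §8–§9 (`lines/g12-2/tree/WakeRatchetMinimalViscousBlowupClockResidueIff.lean` 9d65e4255cdd46b0), landed VERBATIM
by the hand ns-qj-p1 g7 (imports adapted to the tree's split).  `--supports stmt-NavierStokesRegularity-22743 --as helper`.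
[cite: Tao2016AveragedNS, §4 (4.3), Lemma 4.1 (4.5), §5; BarbatoMorandinRomito2011, §3.1]
-/

noncomputable section

set_option linter.dupNamespace false

open Set Filter Topology MeasureTheory
open Literature.Analysis.FluidPDE Literature.Analysis.FluidPDE.TaoCascade

namespace Summit.NavierStokesRegularity.NavierStokesRegularity.Theorems.MinimalViscousBlowup.ThresholdRay

/-! ### §8 The clock residue, exactly: (FC′) ⟺ (H1″) ∧ (H2″) -/

/-- **THE HEART TWIN DECOMPOSED (kernel).**  Along an enveloped blow-up of the NS-scaled `ν`-viscous cascade lattice with the cascade datum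
(S5's binders: C¹, datum, no shells below 0, motion, weight-10 regularity, blow-up at `T`, critical envelope `C`), the FIRED FRONT CLOCK
«`T − t ≤ Kλ^{−2m}` once shell `m` fired (`λᵐ‖X_m‖² ≥ ν²/(32768λ¹⁶)`) by `t`» — the conclusion of `stub_firedFrontClockAtThreshold` (LINE g11-1
v3.9, S5b♭) — is EQUIVALENT to the conjunction of (H1″) «the time shell `k` spends above the darkness level `ν²/(32768λ¹⁹)` is `≤ Aλ^{−2k}`» and
(H2″) «bounded retreat depth: after shell `m` fires, at every later time some shell `n ≥ m − d` is above the darkness level».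
(`litMeasure_of_frontClock₂`, `retreatDepth_of_frontClock`, `frontClock_of_litMeasure_retreatDepth₂`.)  Neither side is claimed; MODEL lattice only.
[cite: Tao2016AveragedNS, §4 (4.3), Lemma 4.1 (4.5), §5; BarbatoMorandinRomito2011, §3.1] -/
theorem firedFrontClock_iff_litMeasure_retreatDepth {ε₀ ν T C : ℝ} (hε : 0 < ε₀) (hν : 0 < ν) (hT : 0 < T)
    {α : Fin 4 → Fin 4 → Fin 4 → ℤ × ℤ × ℤ → ℝ} (hcan : IsCancellingCoeff α)
    (hα1 : ∀ i₁ i₂ i₃, |α i₁ i₂ i₃ (0, 0, 1)| ≤ 1) {X : Fin 4 → ℤ → ℝ → ℝ} {X₀ : Fin 4 → ℝ}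
    (hcd : ∀ i n, ContDiffOn ℝ 1 (X i n) (Ico 0 T))
    (hinit : ∀ i n, X i n 0 = if n = 0 then X₀ i else 0)
    (hlow : ∀ i n t, n < 0 → X i n t = 0)
    (hmot : ∀ i n t, 0 ≤ t → t < T → derivWithin (X i n) (Ici 0) t =
      quadTerm ε₀ α X i n t - ν * (1 + ε₀) ^ ((2 : ℝ) * n) * X i n t)
    (hreg : ∀ T' : ℝ, 0 < T' → T' < T → ∃ M : ℝ, ∀ t : ℝ, 0 ≤ t → t ≤ T' →
      ∀ (i : Fin 4) (n : ℤ), (1 + (1 + ε₀) ^ ((10 : ℝ) * n)) * |X i n t| ≤ M)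
    (hblow : ∀ M : ℝ, ∃ t : ℝ, 0 ≤ t ∧ t < T ∧
      ∃ (i : Fin 4) (n : ℤ), M < (1 + (1 + ε₀) ^ ((10 : ℝ) * n)) * |X i n t|)
    (henv : ∀ (n : ℤ) (t : ℝ), 0 ≤ t → t < T → (1 + ε₀) ^ n * ‖shellVec X n t‖ ^ 2 ≤ C) :
    (∃ K : ℝ, ∀ (m : ℕ) (t : ℝ), 0 ≤ t → t < T →
      (∃ s, 0 ≤ s ∧ s ≤ t ∧ 1 / (32768 * (1 + ε₀) ^ 16) * ν ^ 2 ≤ (1 + ε₀) ^ m * ‖shellVec X m s‖ ^ 2) →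
      T - t ≤ K / (1 + ε₀) ^ (2 * m)) ↔
    ((∃ A : ℝ, 0 ≤ A ∧ ∀ k : ℕ, volume {s : ℝ | 0 ≤ s ∧ s < T ∧
        1 / (32768 * (1 + ε₀) ^ 19) * ν ^ 2 < (1 + ε₀) ^ k * ‖shellVec X k s‖ ^ 2} ≤
        ENNReal.ofReal (A * ((1 + ε₀) ^ 2)⁻¹ ^ k)) ∧
     (∃ d : ℕ, ∀ (m : ℕ) (s₀ s : ℝ), 0 ≤ s₀ → s₀ ≤ s → s < T →
        1 / (32768 * (1 + ε₀) ^ 16) * ν ^ 2 ≤ (1 + ε₀) ^ m * ‖shellVec X m s₀‖ ^ 2 →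
        ∃ n : ℕ, m ≤ n + d ∧ 1 / (32768 * (1 + ε₀) ^ 19) * ν ^ 2 < (1 + ε₀) ^ n * ‖shellVec X n s‖ ^ 2)) := by
  constructor
  · rintro ⟨K, hFC⟩
    exact ⟨⟨max T (K * (1 + ε₀) ^ 2), le_trans hT.le (le_max_left _ _),
        litMeasure_of_frontClock₂ hε hν hcan hα1 hcd hinit hmot hreg hFC⟩,
      retreatDepth_of_frontClock hε hν hT hcan hα1 hcd hlow hmot hreg hblow henv hFC⟩
  · rintro ⟨⟨A, hA, H1⟩, ⟨d, H2⟩⟩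
    exact frontClock_of_litMeasure_retreatDepth₂ hε hA H1 H2

/-! ### §9 The converse for free: S5's Type-I clock ⇒ (FC′) -/

/-- **Type-I pointwise clock ⇒ fired front clock (no slack in the S5 = S5a ∧ S5b♭ cut).**  If `Λⁿ(T − t)‖X_n(t)‖ ≤ C'` for all shells and
times (`Λ = (1+ε₀)^{5/2}`; the first half of S5♭'s conclusion), then once shell `m` has FIRED (level `≥ ν²/(32768λ¹⁶)`) by time `t`, at most
`√(32768 C'² λ¹⁶/ν²)·λ^{−2m}` of life remains: at the firing instant `s ≤ t`, `Λ^{2m}(T−s)²‖X_m(s)‖² ≤ C'²` and `λ^m‖X_m(s)‖² ≥ ν²/(32768λ¹⁶)`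
give `(λ^{2m}(T−s))² ≤ 32768 C'² λ¹⁶/ν²`.  So, given S5's binders, S5♭ ⟹ (FC′) ⟸⟹ (H1″) ∧ (H2″) and (FC′) ⟹ S5♭ (S5a, landed p710688):
the clock residue S5b♭ is EXACTLY as strong as S5♭.  MODEL lattice only. [cite: Tao2016AveragedNS, §4 (4.1), §5] -/
theorem frontClock_of_typeOne {ε₀ ν T C' : ℝ} (hε : 0 < ε₀) (hν : 0 < ν) {X : Fin 4 → ℤ → ℝ → ℝ}
    (htypeI : ∀ (n : ℤ) (t : ℝ), 0 ≤ t → t < T → bigLam ε₀ ^ n * (T - t) * ‖shellVec X n t‖ ≤ C') :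
    ∀ (m : ℕ) (t : ℝ), 0 ≤ t → t < T →
      (∃ s, 0 ≤ s ∧ s ≤ t ∧ 1 / (32768 * (1 + ε₀) ^ 16) * ν ^ 2 ≤ (1 + ε₀) ^ m * ‖shellVec X m s‖ ^ 2) →
      T - t ≤ Real.sqrt (32768 * C' ^ 2 * (1 + ε₀) ^ 16 / ν ^ 2) / (1 + ε₀) ^ (2 * m) := by
  have hl0 : (0 : ℝ) < 1 + ε₀ := by linarith
  have hν2 : 0 < ν ^ 2 := pow_pos hν 2
  have hΛsq : bigLam ε₀ ^ 2 = (1 + ε₀) ^ 5 := by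
    unfold bigLam
    rw [← Real.rpow_two, ← Real.rpow_mul hl0.le, show ((5 : ℝ) / 2 * 2) = ((5 : ℕ) : ℝ) by norm_num, Real.rpow_natCast]
  intro m t ht0 htT ⟨s, hs0, hst, hfire⟩
  have hsT : s < T := lt_of_le_of_lt hst htT
  have h1 := htypeI (m : ℤ) s hs0 hsT
  rw [zpow_natCast] at h1
  have hpos : 0 ≤ bigLam ε₀ ^ m * (T - s) * ‖shellVec X (m : ℤ) s‖ := by
    have : 0 ≤ bigLam ε₀ := by unfold bigLam; positivity
    have : 0 ≤ T - s := by linarith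
    positivity
  have h2 : (bigLam ε₀ ^ m * (T - s) * ‖shellVec X (m : ℤ) s‖) ^ 2 ≤ C' ^ 2 := pow_le_pow_left₀ hpos h1 2
  have hΛm : (bigLam ε₀ ^ m) ^ 2 = (1 + ε₀) ^ (5 * m) := by rw [← pow_mul, mul_comm, pow_mul, hΛsq, ← pow_mul]
  have h3 : (1 + ε₀) ^ (5 * m) * (T - s) ^ 2 * ‖shellVec X (m : ℤ) s‖ ^ 2 ≤ C' ^ 2 := by
    calc (1 + ε₀) ^ (5 * m) * (T - s) ^ 2 * ‖shellVec X (m : ℤ) s‖ ^ 2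
        = (bigLam ε₀ ^ m * (T - s) * ‖shellVec X (m : ℤ) s‖) ^ 2 := by rw [← hΛm]; ring
      _ ≤ C' ^ 2 := h2
  -- combine with the firing level
  have h4 : ((1 + ε₀) ^ (2 * m) * (T - s)) ^ 2 * (1 / (32768 * (1 + ε₀) ^ 16) * ν ^ 2) ≤ C' ^ 2 := by
    have hw : 0 ≤ ((1 + ε₀) ^ (2 * m) * (T - s)) ^ 2 := sq_nonneg _
    calc ((1 + ε₀) ^ (2 * m) * (T - s)) ^ 2 * (1 / (32768 * (1 + ε₀) ^ 16) * ν ^ 2)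
        ≤ ((1 + ε₀) ^ (2 * m) * (T - s)) ^ 2 * ((1 + ε₀) ^ m * ‖shellVec X (m : ℤ) s‖ ^ 2) :=
          mul_le_mul_of_nonneg_left hfire hw
      _ = (1 + ε₀) ^ (5 * m) * (T - s) ^ 2 * ‖shellVec X (m : ℤ) s‖ ^ 2 := by ring
      _ ≤ C' ^ 2 := h3
  have h5 : ((1 + ε₀) ^ (2 * m) * (T - s)) ^ 2 ≤ 32768 * C' ^ 2 * (1 + ε₀) ^ 16 / ν ^ 2 := by
    rw [le_div_iff₀ hν2]
    have hb : 0 < 1 / (32768 * (1 + ε₀) ^ 16) * ν ^ 2 := by positivity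
    have := (le_div_iff₀ hb).mpr h4
    calc ((1 + ε₀) ^ (2 * m) * (T - s)) ^ 2 * ν ^ 2
        ≤ C' ^ 2 / (1 / (32768 * (1 + ε₀) ^ 16) * ν ^ 2) * ν ^ 2 := mul_le_mul_of_nonneg_right this hν2.le
      _ = 32768 * C' ^ 2 * (1 + ε₀) ^ 16 := by field_simp
  have h6 : (1 + ε₀) ^ (2 * m) * (T - s) ≤ Real.sqrt (32768 * C' ^ 2 * (1 + ε₀) ^ 16 / ν ^ 2) :=
    (le_abs_self _).trans (Real.abs_le_sqrt h5)
  have hl2m : 0 < (1 + ε₀) ^ (2 * m) := pow_pos hl0 _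
  rw [le_div_iff₀ hl2m]
  calc (T - t) * (1 + ε₀) ^ (2 * m) ≤ (T - s) * (1 + ε₀) ^ (2 * m) :=
        mul_le_mul_of_nonneg_right (by linarith) hl2m.le
    _ = (1 + ε₀) ^ (2 * m) * (T - s) := mul_comm _ _
    _ ≤ Real.sqrt (32768 * C' ^ 2 * (1 + ε₀) ^ 16 / ν ^ 2) := h6

end Summit.NavierStokesRegularity.NavierStokesRegularity.Theorems.MinimalViscousBlowup.ThresholdRay
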